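import Summits.BirchSwinnertonDyer.BirchSwinnertonDyer.Theorems.SylvesterTwoHeegnerIndexCMDataGeomPackage
import Mathlib.FieldTheory.AlgebraicClosure
import Literature.NumberTheory.EllipticCurves.HuShuYin2019.SylvesterNineMinimalModel
import Literature.NumberTheory.EllipticCurves.ModPImageJ1728CartanProofs
import Literature.NumberTheory.EllipticCurves.GeomPointsEmbeddingDescent
import HarnessLib

/-!
# (H-a) of leaf (L1), crux `UpperOffV0HSYPlus` (stmt-BirchSwinnertonDyer-19804): THE COHERENT FRAME DATA of the
# rows' (F) assembly — one embedding of the whole tower `K[m] ⊂ ℂ` into `K̄`, the pinned transport `κ`, the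
# bottom transversal

Skeleton of record VARIANT M (`Cruxes/UpperOffV0HSYPlus/Lines/coupled_variantM.lean` 406ca288e244d392);
card v28; planner D472/D475 (iv) (the coherence device).  #F1 `flip_levelPrime` / #F2 `flip_levelPair` are stated
for ONE level each with binders `emb, N, N', t, κ`; #19 `disp₀_of_named` for the level `9p` with a PINNED `κ`; #24
`L1_of_cmFrameClasses_four` couples `c_A(ℓ')` (level `9pℓ'`) with `c_B(ℓℓ')` (level `9pℓℓ'`).  The assembly (#H)
therefore needs ALL levels embedded COMPATIBLY and ONE bottom datum; this file provides it:

* `exists_coherent_emb`: `emb_m : K[m] → K̄` over `K` for every `m`, with `emb_n ∘ (K[m] ⊆ K[n]) = emb_m`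
  (ONE `K`-algebra map from the algebraic numbers of `ℂ`, `IsAlgClosed.lift`);
* `exists_frameTransport_pinned`: THE `κ(x, y) = (x/36, (y − 108)/216)` of #19, `Γ_K`-equivariant;
* `exists_bottom_transversal`: `N₀ = Gal(K̄/emb K[9p]) ⊴ Γ_K`, the stabiliser `H` of `(∛3, ∛p)`, lifts `T`, and the
  product representatives `t (q, h) = T(q̃) T(h)` of `Γ_K/N₀` (the `t/ht` of #F1 AND the `(t, ht', ht)` of #G);
* `mem_iff_forall_mem_nine_mul`: `N₀` is the `N'` of #F1/#F2/#R-c at every level, by coherence.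

Theorems only; no `def`, no `sorry`, no new `Prop`.  Honest label: (F)+(G)+(H) close `stub_layerL1Four` only
MODULO {`hD` #19, `Dt`/`hdeg`, (ES2) = `Nekovar2007.cmPoint_frobeniusCongruence`}; BSD is not proved by any of this.
-/

set_option linter.dupNamespace false
set_option autoImplicit false

noncomputable section

open scoped Classical Pointwise

namespace Summit.BirchSwinnertonDyer.BirchSwinnertonDyer.Theorems.SylvesterTwoCMFlip

open WeierstrassCurve Field NumberField IsDedekindDomain Finset
open Literature.NumberTheory.EllipticCurves Literature.NumberTheory.GaloisRepresentations
  Literature.NumberTheory.EllipticCurves.HuShuYin2019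
  Literature.NumberTheory.QuadraticFields.BinaryQuadraticForm
  Summit.BirchSwinnertonDyer.BirchSwinnertonDyer.Theorems.SylvesterTwoCMData

variable {K : Type} [Field K] [NumberField K]

/-- Every ring class field `K[m] ⊂ ℂ` consists of algebraic numbers: it is generated by `ι(K)` (a number field)
and singular moduli `j(τ_Q)` (algebraic integers, Cox Thm. 10.23 / 11.1).
[cite: Cox2013, §10.C Thm. 10.23, Thm. 11.1] -/
theorem ringClassField_le_algebraicClosure (ι : K →+* ℂ) (m : ℕ) :
    ringClassField K ι m ≤ (algebraicClosure ℚ ℂ).toSubfield := by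
  refine Subfield.closure_le.mpr ?_
  rintro x (⟨k, rfl⟩ | hx)
  · show ι k ∈ algebraicClosure ℚ ℂ
    rw [mem_algebraicClosure_iff']
    exact (IsIntegral.of_finite ℚ k).map ι.toRatAlgHom
  · show x ∈ algebraicClosure ℚ ℂ
    rw [mem_algebraicClosure_iff']
    obtain ⟨Q, hQ, rfl⟩ := Finset.mem_image.mp (Finset.mem_coe.mp hx)
    have hQ' := hQ
    simp only [reducedForms, Finset.mem_image, Finset.mem_filter, Finset.mem_product, Finset.mem_Icc] at hQ'
    obtain ⟨⟨a, b⟩, ⟨⟨⟨ha1, -⟩, -⟩, hdvd, hprim, hred⟩, rfl⟩ := hQ'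
    refine isIntegral_formJ (by simpa using (show (0 : ℤ) < a by omega)) hprim ?_
    obtain ⟨h1, h2, h3, -⟩ := hred
    simp only at h1 h2 h3
    rw [discr_apply]
    obtain ⟨c, hc⟩ := hdvd
    have hc' : (b ^ 2 - (m : ℤ) ^ 2 * NumberField.discr K) / (4 * a) = c := by
      rw [hc]; exact Int.mul_ediv_cancel_left _ (by omega)
    rw [hc'] at h3 ⊢
    nlinarith

/-- **COHERENT embeddings of ALL ring class fields `K[m] ⊂ ℂ` into `K̄` over `K`**: one `K`-algebra map from the
algebraic numbers of `ℂ` into `K̄` (`IsAlgClosed.lift`), restricted to each `K[m]`; the restrictions are compatible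
with every inclusion `K[m] ⊆ K[n]` (Gross 1991 §1: *"We consider K, and all other number fields in this paper, as
subfields of ℂ"* — one embedding of that tower into `K̄`).
[cite: GrossLMS1991, §1 (p. 235), §3 (p. 238: K ⊂ K_1 ⊂ K_m ⊂ K_n)] -/
theorem exists_coherent_emb (ι : K →+* ℂ) :
    ∃ emb : (m : ℕ) → (ringClassField K ι m →+* AlgebraicClosure K),
      (∀ (m : ℕ) (k : K), emb m (algebraMap K (ringClassField K ι m) k) = algebraMap K (AlgebraicClosure K) k) ∧
      ∀ (m n : ℕ) (h : ringClassField K ι m ≤ ringClassField K ι n) (x : ringClassField K ι m),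
        emb n (RingClassField.inclusion ι h x) = emb m x := by
  let A : IntermediateField ℚ ℂ := algebraicClosure ℚ ℂ
  have hιA : ∀ k : K, ι k ∈ A := fun k ↦
    ringClassField_le_algebraicClosure ι 1 (apply_mem_ringClassField ι 1 k)
  letI : Algebra K A := (ι.codRestrict A.toSubfield.toSubring hιA).toAlgebra
  have halgK : ∀ k : K, ((algebraMap K A k : A) : ℂ) = ι k := fun _ ↦ rfl
  haveI : IsScalarTower ℚ K A := IsScalarTower.of_algebraMap_eq fun q ↦ by
    apply Subtype.ext
    rw [halgK]
    simp
  haveI : Algebra.IsAlgebraic ℚ A := algebraicClosure.isAlgebraic ℚ ℂ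
  haveI : Algebra.IsAlgebraic K A := Algebra.IsAlgebraic.tower_top (K := ℚ) K
  let Φ : A →ₐ[K] AlgebraicClosure K := IsAlgClosed.lift
  let incl : (m : ℕ) → ringClassField K ι m →+* A := fun m ↦
    (Subfield.inclusion (ringClassField_le_algebraicClosure ι m))
  refine ⟨fun m ↦ Φ.toRingHom.comp (incl m), fun m k ↦ ?_, fun m n h x ↦ ?_⟩
  · have : incl m (algebraMap K (ringClassField K ι m) k) = algebraMap K A k := Subtype.ext rfl
    rw [RingHom.comp_apply, this]
    exact Φ.commutes k
  · have : incl n (RingClassField.inclusion ι h x) = incl m x :=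
      Subtype.ext (RingClassField.coe_inclusion ι h x)
    rw [RingHom.comp_apply, RingHom.comp_apply, this]

/-- **THE PINNED frame transport `κ : E₉(K̄) ≃+ W₀(K̄)`, `κ(x, y) = (x/36, (y − 108)/216)`** (the change of
variables `(u, r, s, t) = (6, 0, 0, 108)` from `E₉ : y² = x³ − 2⁴3⁷` to the minimal model `W₀ : y² + y = x³ − 1`,
read over `K̄`), `Γ_K`-equivariant — the `κ` of #19 `disp₀_of_named` (pinned coordinates) AND of #F1/#F2 (`hκG`,
`hκ` with `(a, b, d) = (1/36, 1/216, −1/2)`). [cite: SilvermanAEC2009, III.1 (Table 3.1), III.3.1(b)]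
[cite: HuShuYin2019, §2 p. 8] -/
theorem exists_frameTransport_pinned (K : Type) [Field K] [CharZero K] :
    ∃ κ : geomPoints ((cubeSumCurve 9).baseChange K) ≃+
        geomPoints ((⟨0, 0, 1, 0, -1⟩ : WeierstrassCurve ℚ).baseChange K),
      (∀ (g : absoluteGaloisGroup K) (P : geomPoints ((cubeSumCurve 9).baseChange K)), κ (g • P) = g • κ P) ∧
      ∀ {x y : AlgebraicClosure K}
        (h : (((cubeSumCurve 9).baseChange K).baseChange (AlgebraicClosure K)).toAffine.Nonsingular x y),
        ∃ h', κ (.some x y h) = .some (x / 36) ((y - 108) / 216) h' := by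
  set C₀ : VariableChange ℚ := ⟨Units.mk0 (6 : ℚ) (by norm_num), 0, 0, 108⟩ with hC₀
  have hC : (C₀.map (algebraMap ℚ K)) • (cubeSumCurve 9).baseChange K =
      (⟨0, 0, 1, 0, -1⟩ : WeierstrassCurve ℚ).baseChange K := by
    rw [← VariableChange.baseChange_smul_eq, hC₀, variableChange_six_smul_cubeSumCurve_nine]
  have e : ((C₀.map (algebraMap ℚ K)) • (cubeSumCurve 9).baseChange K).baseChange (AlgebraicClosure K) =
      ((⟨0, 0, 1, 0, -1⟩ : WeierstrassCurve ℚ).baseChange K).baseChange (AlgebraicClosure K) := by rw [hC]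
  let κ₁ := VariableChange.pointEquivBaseChange ((cubeSumCurve 9).baseChange K) (C₀.map (algebraMap ℚ K))
    (AlgebraicClosure K)
  let κ : geomPoints ((cubeSumCurve 9).baseChange K) ≃+
      geomPoints ((⟨0, 0, 1, 0, -1⟩ : WeierstrassCurve ℚ).baseChange K) := κ₁.trans (Affine.Point.congrEquiv e)
  have hu : (((C₀.map (algebraMap ℚ K)).map (algebraMap K (AlgebraicClosure K))).u⁻¹ : (AlgebraicClosure K)ˣ) =
      ((6 : AlgebraicClosure K)⁻¹ : AlgebraicClosure K) := by
    simp [hC₀, VariableChange.map, map_ofNat]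
  have hX : ∀ x : AlgebraicClosure K,
      ((C₀.map (algebraMap ℚ K)).map (algebraMap K (AlgebraicClosure K))).toX x = x / 36 := by
    intro x
    rw [VariableChange.toX, hu]
    simp [hC₀, VariableChange.map, map_ofNat]
    ring
  have hY : ∀ x y : AlgebraicClosure K,
      ((C₀.map (algebraMap ℚ K)).map (algebraMap K (AlgebraicClosure K))).toY x y = (y - 108) / 216 := by
    intro x y
    rw [VariableChange.toY, hu]
    simp [hC₀, VariableChange.map, map_ofNat]
    ring
  have hformula : ∀ {x y : AlgebraicClosure K}
      (h : (((cubeSumCurve 9).baseChange K).baseChange (AlgebraicClosure K)).toAffine.Nonsingular x y),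
      ∃ h', κ (.some x y h) = .some (x / 36) ((y - 108) / 216) h' := by
    intro x y h
    have e1 : κ (.some x y h) = Affine.Point.congrEquiv e (κ₁ (.some x y h)) := rfl
    rw [VariableChange.pointEquivBaseChange_some, Affine.Point.congrEquiv_some] at e1
    refine ⟨?_, e1.trans (Affine.Point.some_eq_some_of_eq (hX x) (hY x y))⟩
    have h0 := e ▸ (VariableChange.baseChange_smul_eq ((cubeSumCurve 9).baseChange K) (C₀.map (algebraMap ℚ K))
      (AlgebraicClosure K) ▸ (VariableChange.nonsingular_iff (((cubeSumCurve 9).baseChange K).baseChange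
        (AlgebraicClosure K)) ((C₀.map (algebraMap ℚ K)).map (algebraMap K (AlgebraicClosure K))) x y).mpr h)
    rw [hX, hY] at h0
    exact h0
  refine ⟨κ, fun g P ↦ ?_, hformula⟩
  have hg : ∀ z : AlgebraicClosure K, g • z = (show AlgebraicClosure K ≃ₐ[K] AlgebraicClosure K from g) z :=
    fun _ ↦ rfl
  change (((cubeSumCurve 9).baseChange K).baseChange (AlgebraicClosure K)).toAffine.Point at P
  rcases P with _ | ⟨x, y, h⟩
  · change κ (g • (0 : geomPoints ((cubeSumCurve 9).baseChange K))) = g • κ 0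
    rw [smul_zero, map_zero, smul_zero]
  · obtain ⟨h₁, e₁⟩ := geomPoints_smul_some (W := (cubeSumCurve 9).baseChange K) g h
    obtain ⟨h₂, e₂⟩ := hformula h₁
    obtain ⟨h₃, e₃⟩ := hformula h
    obtain ⟨h₄, e₄⟩ := geomPoints_smul_some (W := (⟨0, 0, 1, 0, -1⟩ : WeierstrassCurve ℚ).baseChange K) g h₃
    rw [e₁, e₂, e₃, e₄]
    refine Affine.Point.some_eq_some_of_eq ?_ ?_
    · rw [hg, hg, map_div₀, map_ofNat]
    · rw [hg, hg, map_div₀, map_sub, map_ofNat, map_ofNat]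

/-- **The bottom transversal.**  For an embedded `K[9p]` (`emb` over `K`) and `∛3, ∛p ∈ K[9p]`: the fixer
`N₀ = Gal(K̄/emb K[9p]) ⊴ Γ_K`, the stabiliser `H ≤ 𝒢 = Gal(K[9p]/K)` of `(∛3, ∛p)` (`= Gal(K[9p]/L_{(3p)})`),
lifts `T σ ∈ Γ_K` of the `σ ∈ 𝒢`, and: the PRODUCT representatives `t (q, h) = T(q̃) · T(h)`
(`q̃ = Quotient.out q`) form a system of representatives of `Γ_K/N₀` (Gross's lifts `g̃` of `𝒢_n`, arranged
along `𝒢 = ⨆_q q̃ H`). [cite: GrossLMS1991, §3 (3.3)–(3.4), §4 (4.1)–(4.2)] [cite: HuShuYin2019, §2 Prop. 2.4 (1)] -/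
theorem exists_bottom_transversal (hK : IsImaginaryQuadratic K) (ι : K →+* ℂ) {p : ℕ} (hp0 : p ≠ 0)
    (emb : ringClassField K ι (9 * p) →+* AlgebraicClosure K)
    (hemb : ∀ k : K, emb (algebraMap K (ringClassField K ι (9 * p)) k) = algebraMap K (AlgebraicClosure K) k)
    (c₃ cp : ringClassField K ι (9 * p)) :
    ∃ (N₀ : Subgroup (absoluteGaloisGroup K))
      (_ : ∀ g : absoluteGaloisGroup K, g ∈ N₀ ↔
        ∀ x : ringClassField K ι (9 * p), (show AlgebraicClosure K ≃ₐ[K] AlgebraicClosure K from g) (emb x) = emb x)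
      (H : Subgroup (ringClassField K ι (9 * p) ≃ₐ[K] ringClassField K ι (9 * p)))
      (_ : ∀ σ, σ ∈ H ↔ σ c₃ = c₃ ∧ σ cp = cp)
      (T : (ringClassField K ι (9 * p) ≃ₐ[K] ringClassField K ι (9 * p)) → absoluteGaloisGroup K)
      (_ : ∀ σ (x : ringClassField K ι (9 * p)),
        (show AlgebraicClosure K ≃ₐ[K] AlgebraicClosure K from T σ) (emb x) = emb (σ x)),
      N₀.Normal ∧ Finite (ringClassField K ι (9 * p) ≃ₐ[K] ringClassField K ι (9 * p)) ∧
      ∀ t : ((ringClassField K ι (9 * p) ≃ₐ[K] ringClassField K ι (9 * p)) ⧸ H) × H → absoluteGaloisGroup K,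
        (∀ q h, t (q, h) = T (Quotient.out q) * T (h : _)) →
          Function.Bijective fun i ↦ (t i : absoluteGaloisGroup K ⧸ N₀) := by
  have hm0 : 9 * p ≠ 0 := mul_ne_zero (by norm_num) hp0
  haveI := (finiteDimensional_and_isGalois_ringClassField hK ι hm0).1
  haveI := (finiteDimensional_and_isGalois_ringClassField hK ι hm0).2
  obtain ⟨N₀, hN₀⟩ := exists_subgroup_mem_iff emb hemb
  let H : Subgroup (ringClassField K ι (9 * p) ≃ₐ[K] ringClassField K ι (9 * p)) :=
    MulAction.stabilizer _ ((c₃, cp) : ringClassField K ι (9 * p) × ringClassField K ι (9 * p))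
  have hH : ∀ σ, σ ∈ H ↔ σ c₃ = c₃ ∧ σ cp = cp := fun σ ↦ by
    simp only [H, MulAction.mem_stabilizer_iff, Prod.smul_mk, Prod.mk.injEq, AlgEquiv.smul_def]
  choose T hT using fun σ : ringClassField K ι (9 * p) ≃ₐ[K] ringClassField K ι (9 * p) ↦
    exists_lift_algEquiv emb hemb σ
  refine ⟨N₀, hN₀, H, hH, T, hT, normal_of_mem_iff emb hemb N₀ hN₀, inferInstance, fun t ht ↦ ?_⟩
  -- the finite-level representatives `τ (q, h) = q̃ h` of `𝒢 / ⊥`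
  have hτ : Function.Bijective fun i : ((ringClassField K ι (9 * p) ≃ₐ[K] ringClassField K ι (9 * p)) ⧸ H) × H ↦
      ((Quotient.out i.1 * (i.2 : _) : ringClassField K ι (9 * p) ≃ₐ[K] ringClassField K ι (9 * p)) :
        (ringClassField K ι (9 * p) ≃ₐ[K] ringClassField K ι (9 * p)) ⧸
          (⊥ : Subgroup (ringClassField K ι (9 * p) ≃ₐ[K] ringClassField K ι (9 * p)))) := by
    have hinj : Function.Injective fun i : ((ringClassField K ι (9 * p) ≃ₐ[K] ringClassField K ι (9 * p)) ⧸ H) × H ↦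
        (Quotient.out i.1 * (i.2 : _) : ringClassField K ι (9 * p) ≃ₐ[K] ringClassField K ι (9 * p)) := by
      rintro ⟨q, h⟩ ⟨q', h'⟩ hqq
      dsimp only at hqq
      have hq : q = q' := by
        rw [← QuotientGroup.out_eq' q, ← QuotientGroup.out_eq' q']
        refine QuotientGroup.eq.mpr ?_
        have : (Quotient.out q)⁻¹ * Quotient.out q' =
            (h : ringClassField K ι (9 * p) ≃ₐ[K] ringClassField K ι (9 * p)) *
              (h' : ringClassField K ι (9 * p) ≃ₐ[K] ringClassField K ι (9 * p))⁻¹ := by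
          refine mul_left_cancel (a := Quotient.out q) ?_
          rw [mul_inv_cancel_left, ← mul_assoc, hqq, mul_inv_cancel_right]
        rw [this]
        exact H.mul_mem h.2 (H.inv_mem h'.2)
      subst hq
      have hh : (h : ringClassField K ι (9 * p) ≃ₐ[K] ringClassField K ι (9 * p)) = h' := mul_left_cancel hqq
      rw [Subtype.ext hh]
    refine ⟨fun i j hij ↦ hinj ?_, fun g ↦ ?_⟩
    · have := QuotientGroup.eq.mp hij
      rwa [Subgroup.mem_bot, inv_mul_eq_one] at this
    · obtain ⟨g, rfl⟩ := QuotientGroup.mk_surjective g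
      have hmem : (Quotient.out (g : (ringClassField K ι (9 * p) ≃ₐ[K] ringClassField K ι (9 * p)) ⧸ H))⁻¹ * g ∈ H :=
        QuotientGroup.eq.mp (QuotientGroup.out_eq' _)
      exact ⟨((g : _ ⧸ H), ⟨_, hmem⟩), by simp only [mul_inv_cancel_left]⟩
  refine bijective_quotient_of_finite_level emb hemb Set.univ N₀ (fun g ↦ ?_) ⊥ (fun σ ↦ ?_) _ hτ t
    fun i x ↦ ?_
  · rw [hN₀]; simp only [Set.mem_univ, forall_true_left]
  · rw [Subgroup.mem_bot]
    exact ⟨fun h x _ ↦ by rw [h]; rfl, fun h ↦ AlgEquiv.ext fun x ↦ h x trivial⟩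
  · obtain ⟨q, h⟩ := i
    rw [ht, AlgEquiv.mul_apply]
    change (show AlgebraicClosure K ≃ₐ[K] AlgebraicClosure K from T (Quotient.out q))
      ((show AlgebraicClosure K ≃ₐ[K] AlgebraicClosure K from T (h : _)) (emb x)) = _
    rw [hT, hT]

/-- **`N'` read at a higher level**: with coherent embeddings (`emb_n ∘ incl = emb_{9p}` on `K[9p] ⊆ K[n]`), the
fixer `N₀` of `emb K[9p]` IS the subgroup fixing `emb_n x` for the `x ∈ K[n]` lying in `K[9p]` — the binder `hN'`
of #F1/#F2/#R-c at every level `n`. [cite: GrossLMS1991, §3 (p. 238: K_m ⊂ K_n)] -/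
theorem mem_iff_forall_mem_nine_mul (ι : K →+* ℂ) {p n : ℕ}
    (hle : ringClassField K ι (9 * p) ≤ ringClassField K ι n)
    (emb₀ : ringClassField K ι (9 * p) →+* AlgebraicClosure K) (emb : ringClassField K ι n →+* AlgebraicClosure K)
    (hcoh : ∀ x : ringClassField K ι (9 * p), emb (RingClassField.inclusion ι hle x) = emb₀ x)
    {N₀ : Subgroup (absoluteGaloisGroup K)}
    (hN₀ : ∀ g : absoluteGaloisGroup K, g ∈ N₀ ↔
      ∀ x : ringClassField K ι (9 * p), (show AlgebraicClosure K ≃ₐ[K] AlgebraicClosure K from g) (emb₀ x) = emb₀ x)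
    (g : absoluteGaloisGroup K) :
    g ∈ N₀ ↔ ∀ x ∈ {x : ringClassField K ι n | (x : ℂ) ∈ ringClassField K ι (9 * p)},
      (show AlgebraicClosure K ≃ₐ[K] AlgebraicClosure K from g) (emb x) = emb x := by
  rw [hN₀]
  constructor
  · intro h x hx
    have e : x = RingClassField.inclusion ι hle ⟨(x : ℂ), hx⟩ :=
      Subtype.ext (by rw [RingClassField.coe_inclusion])
    rw [e, hcoh]
    exact h _
  · intro h x
    rw [← hcoh]
    exact h _ (by
      show ((RingClassField.inclusion ι hle x : ringClassField K ι n) : ℂ) ∈ ringClassField K ι (9 * p)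
      rw [RingClassField.coe_inclusion]; exact x.2)

end Summit.BirchSwinnertonDyer.BirchSwinnertonDyer.Theorems.SylvesterTwoCMFlip

end
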